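import Summits.MatrixMultiplication.MatrixMultiplication.Theorems.LevelGradedCohnUmansLevelOneGL2DesignsParabolaFreeSearch

/-!
# Parabola-free sets of `ℤ_p²`: soundness of the verified branch and bound
(stub `stub_tangencySets` of the crux `LevelOneGL2Designs`, stmt-MatrixMultiplication-14080;
wall-breaker axis 5/12, *parabola lifts over finite fields*, family P2-mod)

Soundness, at the level of bit masks, of the column branch and bound `PFS.search` / `PFS.topA` of
`…ParabolaFreeSearch.lean`: `search_false` (by induction on the fuel: the bound
`Σ min(cap, |avail_y|)` dominates every admissible family; the enumeration `choose` visits every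
admissible subset of the chosen column, `choose_false`; the killed set it accumulates clears
exactly the neighbours, so the restricted family stays admissible) and `topA_false` (the initial
packing).  The popcount table enters through the hypothesis
`Hpc : ∀ m < 2^p, pc p m = (bitsOf p m).length`, decided per `p` in the instance files.
-/

set_option linter.dupNamespace false -- `MatrixMultiplication.MatrixMultiplication` (summit = problem, D-0017)

namespace Summit.MatrixMultiplication.MatrixMultiplication.Theorems.LevelOneGL2Designs.PFS

/-! ## Soundness of the search -/

/-- the first component of `scan` is the bound `Σ min cap |avail_y|` -/
theorem scan_fst (p cap AV : ℕ) (cols : List ℕ) :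
    (scan p cap AV cols).1 = (cols.map fun y => min cap (pc p (lane p AV y))).sum := by
  induction cols with
  | nil => rfl
  | cons y ys ih =>
    simp only [scan, List.map_cons, List.sum_cons]
    rcases h : scan p cap AV ys with ⟨b, _ | ⟨y', a'⟩⟩ <;> simp_all

/-- the second component of `scan` is a remaining column with its avail-count (or signals that none is left) -/
theorem scan_snd (p cap AV : ℕ) (cols : List ℕ) :
    match (scan p cap AV cols).2 with
    | none => cols = []
    | some (x, a) => x ∈ cols ∧ a = pc p (lane p AV x) := by
  induction cols with
  | nil => simp [scan]
  | cons y ys ih =>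
    simp only [scan]
    rcases h : scan p cap AV ys with ⟨b, _ | ⟨y', a'⟩⟩
    · simp
    · rw [h] at ih
      obtain ⟨hy', ha'⟩ : y' ∈ ys ∧ a' = pc p (lane p AV y') := ih
      by_cases hle : pc p (lane p AV y) ≤ a'
      · simp [hle]
      · dsimp only
        rw [if_neg hle]
        exact ⟨List.mem_cons_of_mem _ hy', ha'⟩

/-- completeness of the subset enumeration: if `choose … = false` then `k` is `false` at every
admissible subset (listed as a sub-list `S`), with the killed set accumulated along `S` -/
theorem choose_false {p cap lo x : ℕ} {k : ℕ → ℕ → Bool} :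
    ∀ (bits : List ℕ) (len kacc cnt : ℕ), bits.length ≤ len →
      choose p cap lo x k bits len kacc cnt = false →
      ∀ S : List ℕ, S.Sublist bits → cnt + S.length ≤ cap → lo ≤ cnt + S.length →
        k (S.foldl (fun acc i => acc ||| nbT p x i) kacc) (cnt + S.length) = false := by
  intro bits
  induction bits with
  | nil =>
    intro len kacc cnt _ hch S hS hcap hlo
    rw [List.sublist_nil.1 hS] at hlo ⊢
    simp only [List.length_nil, add_zero] at hlo ⊢
    simpa [choose, hlo] using hch
  | cons i is ih =>
    intro len kacc cnt hlen hch S hS hcap hlo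
    simp only [choose] at hch
    simp only [List.length_cons] at hlen
    by_cases hprune : cnt + len < lo
    · exfalso
      have := hS.length_le
      simp only [List.length_cons] at this
      omega
    rw [if_neg hprune, Bool.or_eq_false_iff, Bool.and_eq_false_imp, decide_eq_true_eq] at hch
    rcases List.sublist_cons_iff.1 hS with hS | ⟨r, rfl, hr⟩
    · exact ih (len - 1) kacc cnt (by omega) hch.2 S hS hcap hlo
    · simp only [List.length_cons] at hcap hlo ⊢
      have h := ih (len - 1) (kacc ||| nbT p x i) (cnt + 1) (by omega) (hch.1 (by omega)) r hr
        (by omega) (by omega)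
      rw [List.foldl_cons]
      convert h using 2
      omega

/-- the initial column list has no duplicates -/
theorem cols₀_nodup (p : ℕ) : (cols₀ p).Nodup :=
  (List.nodup_range).map fun _ _ h => Nat.succ_injective h

/-- the initial column list is `[1, p)` -/
theorem mem_cols₀ {p y : ℕ} : y ∈ cols₀ p ↔ 1 ≤ y ∧ y < p := by
  simp only [cols₀, List.mem_map, List.mem_range]
  constructor
  · rintro ⟨i, hi, rfl⟩; omega
  · rintro ⟨h1, h2⟩; exact ⟨y - 1, by omega, by omega⟩

/-- soundness of the search: `false` excludes every admissible family `M` of column sets -/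
theorem search_false {p : ℕ} (Hpc : ∀ m < 2 ^ p, pc p m = (bitsOf p m).length) {cap need : ℕ} :
    ∀ (fuel : ℕ) (cols : List ℕ) (AV total : ℕ),
      search p fuel cols AV total cap need = false → cols.Nodup → cols.length ≤ fuel →
      ∀ M : ℕ → ℕ,
        (∀ y ∈ cols, ∀ j, (M y).testBit j = true → (lane p AV y).testBit j = true) →
        (∀ y ∈ cols, (bitsOf p (M y)).length ≤ cap) →
        (∀ y ∈ cols, ∀ y' ∈ cols, y ≠ y' → ∀ i j, (M y).testBit i = true →
          (M y').testBit j = true → (nbT p y i).testBit (16 * y' + j) = false) →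
        total + (cols.map fun y => (bitsOf p (M y)).length).sum < need := by
  intro fuel
  induction fuel with
  | zero => intro cols AV total h; simp [search] at h
  | succ fuel ih =>
    intro cols AV total hs hnd hlen M hsub hcap hcompat
    rw [search] at hs
    by_cases hnt : need ≤ total
    · simp [hnt] at hs
    rw [if_neg hnt] at hs
    have hfst := scan_fst p cap AV cols
    have hsnd := scan_snd p cap AV cols
    -- the bound dominates the family
    have hdom : ∀ y ∈ cols, (bitsOf p (M y)).length ≤ min cap (pc p (lane p AV y)) := fun y hy =>
      le_min (hcap y hy) (by rw [Hpc _ (lane_lt p AV y)]; exact length_bitsOf_le (hsub y hy))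
    have hsumle : (cols.map fun y => (bitsOf p (M y)).length).sum ≤
        (cols.map fun y => min cap (pc p (lane p AV y))).sum :=
      List.sum_le_sum fun y hy => hdom y hy
    rcases hsc : scan p cap AV cols with ⟨b, _ | ⟨x, a⟩⟩
    · rw [hsc] at hsnd
      simp only at hsnd
      subst hsnd
      simp only [List.map_nil, List.sum_nil, add_zero]
      omega
    rw [hsc] at hs hsnd hfst
    simp only at hs hsnd hfst
    obtain ⟨hx, rfl⟩ := hsnd
    by_cases hb : total + b < need
    · calc total + (cols.map fun y => (bitsOf p (M y)).length).sum
          ≤ total + b := by rw [hfst]; exact Nat.add_le_add_left hsumle _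
        _ < need := hb
    rw [if_neg hb] at hs
    -- split the sum at `x`
    have hperm := List.perm_cons_erase hx
    have hsplit : ∀ f : ℕ → ℕ, (cols.map f).sum = f x + ((cols.erase x).map f).sum := fun f => by
      rw [(hperm.map f).sum_eq, List.map_cons, List.sum_cons]
    set R := ((cols.erase x).map fun y => min cap (pc p (lane p AV y))).sum with hR
    have hbR : b = min cap (pc p (lane p AV x)) + R := by rw [hfst, hsplit]
    have hrest : ((cols.erase x).map fun y => (bitsOf p (M y)).length).sum ≤ R :=
      List.sum_le_sum fun y hy => hdom y (List.mem_of_mem_erase hy)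
    rw [hsplit]
    -- small column `x`: the bound alone
    by_cases hlo : (bitsOf p (M x)).length < need - (total + (b - min cap (pc p (lane p AV x))))
    · omega
    -- otherwise `M x` is among the enumerated subsets
    have hMx : bitsOf p (M x) = (bitsOf p (lane p AV x)).filter fun i => (M x).testBit i :=
      bitsOf_eq_filter (hsub x hx)
    have hSl : (bitsOf p (M x)).Sublist (bitsOf p (lane p AV x)) := by
      rw [hMx]; exact List.filter_sublist
    have hk := choose_false _ _ 0 0 le_rfl hs (bitsOf p (M x)) hSl (by simpa using hcap x hx)
      (by omega)
    simp only [zero_add] at hk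
    set K := (bitsOf p (M x)).foldl (fun acc i => acc ||| nbT p x i) 0 with hK
    have hKbit : ∀ n, K.testBit n = true ↔ ∃ i ∈ bitsOf p (M x), (nbT p x i).testBit n = true :=
      fun n => by rw [hK, testBit_foldl_or]; simp
    -- apply the induction hypothesis to the remaining columns
    have hnd' : (cols.erase x).Nodup := hnd.erase x
    have hlen' : (cols.erase x).length ≤ fuel := by
      rw [List.length_erase_of_mem hx]; omega
    have hmem : ∀ y ∈ cols.erase x, y ∈ cols ∧ y ≠ x := fun y hy =>
      ⟨List.mem_of_mem_erase hy, fun h => (List.Nodup.not_mem_erase hnd) (h ▸ hy)⟩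
    have IH := ih (cols.erase x) ((AV ||| K) ^^^ K) (total + (bitsOf p (M x)).length) hk hnd' hlen'
      M ?_ (fun y hy => hcap y (hmem y hy).1)
      (fun y hy y' hy' => hcompat y (hmem y hy).1 y' (hmem y' hy').1)
    · omega
    · intro y hy j hj
      obtain ⟨hyc, hyx⟩ := hmem y hy
      have h1 := hsub y hyc j hj
      rw [testBit_lane, Bool.and_eq_true] at h1 ⊢
      refine ⟨?_, h1.2⟩
      rw [testBit_andNot, h1.1, Bool.true_and, Bool.not_eq_true', Bool.eq_false_iff]
      intro hKn
      obtain ⟨i, hi, hin⟩ := (hKbit _).1 hKn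
      have := hcompat x hx y hyc (Ne.symm hyx) i j (mem_bitsOf.1 hi).2 hj
      rw [this] at hin
      exact Bool.false_ne_true hin

/-- soundness of the top level: if `topA p K m A = false`, every family `M` of column sets for the
columns `1 … p-1`, with bits `< p` not adjacent to the column-0 set `A`, at most `m` bits each and
pairwise non-adjacent, has `m + Σ_y |M y| < K` -/
theorem topA_false {p : ℕ} (Hpc : ∀ m < 2 ^ p, pc p m = (bitsOf p m).length) (hp16 : p ≤ 16)
    {K m A : ℕ} (h : topA p K m A = false)
    (M : ℕ → ℕ)
    (hsub : ∀ y, 1 ≤ y → y < p → ∀ j, (M y).testBit j = true →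
      j < p ∧ ∀ i ∈ bitsOf p A, (nbT p 0 i).testBit (16 * y + j) = false)
    (hcap : ∀ y, 1 ≤ y → y < p → (bitsOf p (M y)).length ≤ m)
    (hcompat : ∀ y y', 1 ≤ y → y < p → 1 ≤ y' → y' < p → y ≠ y' → ∀ i j,
      (M y).testBit i = true → (M y').testBit j = true → (nbT p y i).testBit (16 * y' + j) = false) :
    m + ((cols₀ p).map fun y => (bitsOf p (M y)).length).sum < K := by
  refine search_false Hpc p (cols₀ p) _ m h (cols₀_nodup p) (by simp [cols₀]) M ?_
    (fun y hy => hcap y (mem_cols₀.1 hy).1 (mem_cols₀.1 hy).2)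
    (fun y hy y' hy' hne => hcompat y y' (mem_cols₀.1 hy).1 (mem_cols₀.1 hy).2
      (mem_cols₀.1 hy').1 (mem_cols₀.1 hy').2 hne)
  intro y hy j hj
  obtain ⟨hy1, hyp⟩ := mem_cols₀.1 hy
  obtain ⟨hjp, hA⟩ := hsub y hy1 hyp j hj
  have hj16 : j < 16 := hjp.trans_le hp16
  rw [testBit_lane, testBit_andNot, Bool.and_eq_true, Bool.and_eq_true, decide_eq_true_eq,
    testBit_fullAV hp16 hj16, Bool.not_eq_true', Bool.eq_false_iff]
  refine ⟨⟨⟨hyp, by omega, hjp⟩, fun hk => ?_⟩, hjp⟩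
  obtain ⟨i, hi, hin⟩ := (testBit_killA _ _ _).1 hk
  rw [hA i hi] at hin
  exact Bool.false_ne_true hin


end Summit.MatrixMultiplication.MatrixMultiplication.Theorems.LevelOneGL2Designs.PFS
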